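import Summits.CriticalPhenomena.PercolationContinuityZ3.Theorems.PercNonProliferationFreeBoxSparseStubCollarUnits
import Summits.CriticalPhenomena.PercolationContinuityZ3.Theorems.PercNonProliferationFreeBoxSparseStubCollarArith
import Mathlib.Analysis.SpecialFunctions.Pow.Real
import Mathlib.Analysis.SpecialFunctions.Sqrt

/-!
# Crux `PercNonProliferation.FreeBoxSparse` (stmt-CriticalPhenomena-4445), line `ccfs-window-kissing-walls` —
# `stub_collar` from its three registered pieces (lead's assembly; registered sub-goal `stub_collar_of_pieces`)

`stub_collar_of_pieces : collarGeom → collarWindow → collarGrid → stub_collar` (all four statements def-free,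
verbatim the registered stub texts `stub_collarGeom`, `stub_collarWindow`, `stub_collarGrid`, `stub_collar` of the
skeleton `Cruxes/FreeBoxSparse/Lines/ccfs_window_kissing_walls.lean`).  The pieces: GEOMETRY (one of the 8
half-shifted cubic tilings of side `L = 4r+2` carries at least `V/(8L³)` tiles containing a doubly-met `r`-ball
`⊆ Λ`), the CCFS WINDOW (template sprinkling at density `s` with `|𝒰| s² ≤ p^u` moves no `Λ.sym2`-determined
event by more than `s √(|𝒰|/p^u)`), and the INCREMENT GRID (along `s = k/m`, `k < L₀ ≤ m`, some level has
sprinkled probability of "two δ-dense unjoined pieces with ≥ m good units" at most `1/(δ² L₀)`).  Assembly: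
units = lattice edges of `Λ.sym2` inside one tile (`StubCollarUnits`); `m₀ = ⌈|Λ|^{1/2+σ}/(8L³)⌉`,
`L₀ = ⌊|Λ|^{σ/2}⌋`; for `|Λ| ≥ max(A², (A²/p^u)^{1/σ}, 1)` (`A = 8L³`):
`P ≤ 8 · (2/δ² + A p^{-u/2}) · |Λ|^{-σ/2}`; smaller `|Λ|` absorbed in the constant; `r = 0` and `Λ = ∅` give
empty events.

The exponent bookkeeping is `StubCollarAssembly.collar_arith` (`StubCollarArith`); here: offsets, unit sizes, and the assembly.
-/

noncomputable section

namespace Summit.CriticalPhenomena.PercolationContinuityZ3.Theorems.FreeBoxSparse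

open MeasureTheory Filter
open Literature.Probability.Percolation Literature.Probability.LatticeModels
open scoped Topology Classical


/-- The eight half-shifted offsets `o ∈ {0, 2r+1}³`. [folklore] -/
theorem mem_offsets {r : ℕ} {o : Fin 3 → ℤ} (ho : ∀ j, o j = 0 ∨ o j = 2 * (r : ℤ) + 1) :
    o ∈ Fintype.piFinset (fun _ : Fin 3 => ({0, 2 * (r : ℤ) + 1} : Finset ℤ)) := by
  rw [Fintype.mem_piFinset]
  intro j
  rcases ho j with h | h <;> simp [h]

/-- There are at most eight offsets. [folklore] -/
theorem card_offsets_le (r : ℕ) :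
    (Fintype.piFinset (fun _ : Fin 3 => ({0, 2 * (r : ℤ) + 1} : Finset ℤ))).card ≤ 8 := by
  rw [Fintype.card_piFinset, Finset.prod_const, Finset.card_univ, Fintype.card_fin]
  have : (({0, 2 * (r : ℤ) + 1} : Finset ℤ)).card ≤ 2 := Finset.card_le_two
  calc (({0, 2 * (r : ℤ) + 1} : Finset ℤ)).card ^ 3 ≤ 2 ^ 3 := Nat.pow_le_pow_left this 3
    _ = 8 := by norm_num

/-- Units of a cubic tiling of side `4r+2` have at most `C((4r+2)³+1, 2)` edges. [folklore] -/
theorem card_tileUnit_le (r : ℕ) (o : Fin 3 → ℤ) (Λ : Finset (Site 3)) (ι : Site 3) :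
    ((Λ.sym2).filter (fun e => e ∈ (zdGraph 3).edgeSet ∧
        ∀ z ∈ e, (fun z : Site 3 => fun j : Fin 3 => (z j - o j) / (4 * (r : ℤ) + 2)) z = ι)).card ≤
      ((4 * r + 2) ^ 3 + 1).choose 2 := by
  refine StubCollarAssembly.card_unit_le ?_
  have hL : (0 : ℤ) < 4 * (r : ℤ) + 2 := by positivity
  have h := StubCollarAssembly.card_fibre_tile_le hL o ι Λ
  have htn : (4 * (r : ℤ) + 2).toNat = 4 * r + 2 := by omega
  rw [htn] at h
  exact h

/-- **Registered sub-goal `stub_collar_of_pieces`: `stub_collar` from its three pieces** — geometry (8 half-shifted tilings), the CCFS window (template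
sprinkling moves `Λ.sym2`-determined events by `≤ s√(|𝒰|/p^u)` when `|𝒰|s² ≤ p^u`) and the increment grid
(some level `k/m`, `k < L₀ ≤ m`, has sprinkled probability `≤ 1/(δ²L₀)` of "two δ-dense unjoined pieces with
`≥ m` good units").  All four statements are the registered, def-free stub texts of the line. [folklore] -/
theorem stub_collar_of_pieces :
    (∀ (r : ℕ) (Λ : Finset (Site 3)) (ω : BondConfig (Site 3)) (x y : Site 3), ∃ o : Fin 3 → ℤ, (∀ j, o j = 0 ∨ o j = 2 * (r : ℤ) + 1) ∧ (Set.ncard {a : Site 3 | a ∈ Λ ∧ (box 3 r).image (· + a) ⊆ Λ ∧ (∃ u ∈ Λ, (Finset.univ.sup fun j : Fin 3 => (u j - a j).natAbs) ≤ r ∧ ω ∈ openConnIn ↑Λ x u) ∧ (∃ u ∈ Λ, (Finset.univ.sup fun j : Fin 3 => (u j - a j).natAbs) ≤ r ∧ ω ∈ openConnIn ↑Λ y u)} : ℝ) ≤ 8 * (4 * (r : ℝ) + 2) ^ 3 * (Set.ncard {ι : Site 3 | ∃ a : Site 3, (box 3 r).image (· + a) ⊆ Λ ∧ (∀ z ∈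 (box 3 r).image (· + a), (fun j => (z j - o j) / (4 * (r : ℤ) + 2)) = ι) ∧ (∃ u ∈ Λ, (Finset.univ.sup fun j : Fin 3 => (u j - a j).natAbs) ≤ r ∧ ω ∈ openConnIn ↑Λ x u) ∧ (∃ u ∈ Λ, (Finset.univ.sup fun j : Fin 3 => (u j - a j).natAbs) ≤ r ∧ ω ∈ openConnIn ↑Λ y u)} : ℝ)) → (∀ (p : unitInterval), 0 < (p : ℝ) → ∀ (u : ℕ) (Λ : Finset (Site 3)) (𝒰 : Finset (Finset (Sym2 (Site 3)))), (∀ W ∈ 𝒰, ∀ e ∈ W, e ∈ (zdGraph 3).edgeSet ∧ e ∈ Λ.sym2) → (↑𝒰 : Set (Finset (Sym2 (Site 3)))).PairwiseDisjoint id → (∀ W ∈ 𝒰, W.card ≤ u) → ∀ s : ℝ, 0 ≤ s → s ≤ 1 → (𝒰.card : ℝ) * s ^ 2 ≤ (p : ℝ) ^ u → ∀ A : Set (BondConfig (Site 3)), DeterminedBy A (↑(Λ.sym2) : Set (Sym2 (Site 3))) → |(∑ J ∈ 𝒰.powerset, s ^ J.card * (1 - s) ^ (𝒰.card - J.card) *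 (bondPercolation (zdGraph 3) p).real {ω | ω ∪ (↑(J.biUnion id) : Set (Sym2 (Site 3))) ∈ A}) - (bondPercolation (zdGraph 3) p).real A| ≤ s * Real.sqrt ((𝒰.card : ℝ) / (p : ℝ) ^ u)) → (∀ (p : unitInterval) (Λ : Finset (Site 3)) (𝒰 : Finset (Finset (Sym2 (Site 3)))), (∀ W ∈ 𝒰, ∀ e ∈ W, e ∈ (zdGraph 3).edgeSet ∧ e ∈ Λ.sym2) → (↑𝒰 : Set (Finset (Sym2 (Site 3)))).PairwiseDisjoint id → ∀ δ : ℝ, 0 < δ → ∀ (r m L₀ : ℕ), 1 ≤ L₀ → L₀ ≤ m → ∃ k : ℕ, k < L₀ ∧ (∑ J ∈ 𝒰.powerset, ((k : ℝ) / m) ^ J.card * (1 - (k : ℝ) / m) ^ (𝒰.card - J.card) * (bondPercolation (zdGraph 3) p).real {ω | ω ∪ (↑(J.biUnion id) : Set (Sym2 (Site 3))) ∈ {ω' | ∃ x ∈ Λ, ∃ y ∈ Λ, δ * (Λ.card : ℝ) ≤ (((Λ.filter fun v => ω' ∈ openConnIn ↑Λ x v)).card : ℝ) ∧ δ * (Λ.card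 : ℝ) ≤ (((Λ.filter fun v => ω' ∈ openConnIn ↑Λ y v)).card : ℝ) ∧ ω' ∉ openConnIn ↑Λ x y ∧ m ≤ (𝒰.filter fun W => ∃ a : Site 3, (box 3 r).image (· + a) ⊆ Λ ∧ (∀ b ∈ (box 3 r).image (· + a), ∀ c ∈ (box 3 r).image (· + a), (zdGraph 3).Adj b c → s(b, c) ∈ W) ∧ (∃ u ∈ Λ, (Finset.univ.sup fun j : Fin 3 => (u j - a j).natAbs) ≤ r ∧ ω' ∈ openConnIn ↑Λ x u) ∧ (∃ u ∈ Λ, (Finset.univ.sup fun j : Fin 3 => (u j - a j).natAbs) ≤ r ∧ ω' ∈ openConnIn ↑Λ y u)).card}}) ≤ 1 / (δ ^ 2 * L₀)) → (∀ (p : unitInterval), 0 < (p : ℝ) → (p : ℝ) < 1 → ∀ δ σ : ℝ, 0 < δ → 0 < σ → ∀ r : ℕ, ∃ C : ℝ, ∀ Λ : Finset (Site 3), (bondPercolation (zdGraph 3) p).real {ω | ∃ x ∈ Λ, ∃ y ∈ Λ, δ * (Λ.card : ℝ) ≤ (((Λ.filter fun v => ω ∈ openConnIn ↑Λ x v)).card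 : ℝ) ∧ δ * (Λ.card : ℝ) ≤ (((Λ.filter fun v => ω ∈ openConnIn ↑Λ y v)).card : ℝ) ∧ ω ∉ openConnIn ↑Λ x y ∧ ((Λ.card : ℝ)) ^ ((1 : ℝ) / 2 + σ) ≤ (Set.ncard {a : Site 3 | a ∈ Λ ∧ (box 3 r).image (· + a) ⊆ Λ ∧ (∃ u ∈ Λ, (Finset.univ.sup fun j : Fin 3 => (u j - a j).natAbs) ≤ r ∧ ω ∈ openConnIn ↑Λ x u) ∧ (∃ u ∈ Λ, (Finset.univ.sup fun j : Fin 3 => (u j - a j).natAbs) ≤ r ∧ ω ∈ openConnIn ↑Λ y u)} : ℝ)} ≤ C * ((Λ.card : ℝ)) ^ (-(σ / 2))) := by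
  intro hGeom hWindow hGrid p hp0 hp1 δ σ hδ hσ r
  set μ := bondPercolation (zdGraph 3) p with hμ
  haveI : IsProbabilityMeasure μ := by rw [hμ]; infer_instance
  -- degenerate radius: the event is empty
  rcases Nat.eq_zero_or_pos r with hr0 | hr1
  · subst hr0
    refine ⟨0, fun Λ => ?_⟩
    rw [zero_mul]
    refine le_of_eq (measureReal_eq_zero_iff (measure_ne_top _ _) |>.2 ?_)
    refine measure_mono_null (fun ω hω => ?_) measure_empty
    exfalso
    have hx : ∃ x, x ∈ Λ := by obtain ⟨x, hx, -⟩ := hω; exact ⟨x, hx⟩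
    obtain ⟨x, hx⟩ := hx
    have hN : (1 : ℝ) ≤ Λ.card := by exact_mod_cast Finset.card_pos.2 ⟨x, hx⟩
    have hc : (0 : ℝ) < ((Λ.card : ℝ)) ^ ((1 : ℝ) / 2 + σ) := Real.rpow_pos_of_pos (by linarith) _
    exact StubCollarAssembly.not_mem_collarEvent_zero Λ δ _ hc ω (by simpa using hω)
  -- constants
  set A : ℝ := 8 * (4 * (r : ℝ) + 2) ^ 3 with hA
  set u : ℕ := ((4 * r + 2) ^ 3 + 1).choose 2 with hu
  set q : ℝ := (p : ℝ) ^ u with hq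
  have hA1 : 1 ≤ A := by
    have : (1 : ℝ) ≤ 4 * (r : ℝ) + 2 := by linarith [(Nat.cast_nonneg r : (0 : ℝ) ≤ r)]
    have h3 : (1 : ℝ) ≤ (4 * (r : ℝ) + 2) ^ 3 := one_le_pow₀ this
    linarith
  have hA0 : 0 < A := by linarith
  have hq0 : 0 < q := pow_pos hp0 u
  have hq1 : q ≤ 1 := pow_le_one₀ p.2.1 p.2.2
  set B : ℝ := A ^ 2 / q with hB
  have hB0 : 0 ≤ B := by positivity
  set N₁ : ℝ := B ^ σ⁻¹ with hN₁
  set M : ℝ := max (max (A ^ 2) N₁) 1 with hM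
  have hM1 : 1 ≤ M := le_max_right _ _
  have hM0 : 0 < M := by linarith
  set K : ℝ := 2 / δ ^ 2 + A / Real.sqrt q with hK
  have hK0 : 0 ≤ K := by positivity
  refine ⟨8 * K + M ^ (σ / 2), fun Λ => ?_⟩
  have hC0 : 0 ≤ 8 * K + M ^ (σ / 2) := by positivity
  set N : ℝ := (Λ.card : ℝ) with hN
  -- empty `Λ`
  rcases Λ.eq_empty_or_nonempty with hΛ | hΛ
  · have h0 : μ.real {ω | ∃ x ∈ Λ, ∃ y ∈ Λ, δ * (Λ.card : ℝ) ≤ (((Λ.filter fun v => ω ∈ openConnIn ↑Λ x v)).card : ℝ) ∧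
            δ * (Λ.card : ℝ) ≤ (((Λ.filter fun v => ω ∈ openConnIn ↑Λ y v)).card : ℝ) ∧
            ω ∉ openConnIn ↑Λ x y ∧
            ((Λ.card : ℝ)) ^ ((1 : ℝ) / 2 + σ) ≤
              (Set.ncard {a : Site 3 | a ∈ Λ ∧ (box 3 r).image (· + a) ⊆ Λ ∧ (∃ u ∈ Λ, (Finset.univ.sup fun j : Fin 3 => (u j - a j).natAbs) ≤ r ∧ ω ∈ openConnIn ↑Λ x u) ∧ (∃ u ∈ Λ, (Finset.univ.sup fun j : Fin 3 => (u j - a j).natAbs) ≤ r ∧ ω ∈ openConnIn ↑Λ y u)} : ℝ)} = 0 := by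
      rw [measureReal_eq_zero_iff (measure_ne_top _ _)]
      refine measure_mono_null ?_ measure_empty
      rintro ω ⟨x, hx, -⟩
      rw [hΛ] at hx
      simp at hx
    rw [h0]
    positivity
  have hN1 : 1 ≤ N := by
    have h1 : 1 ≤ Λ.card := Finset.card_pos.2 hΛ
    rw [hN]; exact_mod_cast h1
  have hN0 : 0 < N := by linarith
  -- small `Λ`: probability ≤ 1 ≤ M^{σ/2} N^{-σ/2}
  by_cases hsmall : N ≤ M
  · have h1 : (1 : ℝ) ≤ M ^ (σ / 2) * N ^ (-(σ / 2)) := by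
      have hmono : M ^ (-(σ / 2)) ≤ N ^ (-(σ / 2)) :=
        Real.rpow_le_rpow_of_nonpos hN0 hsmall (by linarith)
      have hone : M ^ (σ / 2) * M ^ (-(σ / 2)) = 1 := by
        rw [← Real.rpow_add hM0]; simp
      calc (1 : ℝ) = M ^ (σ / 2) * M ^ (-(σ / 2)) := hone.symm
        _ ≤ M ^ (σ / 2) * N ^ (-(σ / 2)) := by gcongr
    calc μ.real _ ≤ 1 := measureReal_le_one
      _ ≤ M ^ (σ / 2) * N ^ (-(σ / 2)) := h1
      _ ≤ (8 * K + M ^ (σ / 2)) * N ^ (-(σ / 2)) := by gcongr; linarith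
  push Not at hsmall
  -- large `Λ`: the main estimate
  have hNA : A ^ 2 ≤ N := ((le_max_left _ _).trans (le_max_left _ _)).trans hsmall.le
  have hNB : A ^ 2 / q ≤ N ^ σ := by
    have h1 : N₁ ≤ N := ((le_max_right _ _).trans (le_max_left _ _)).trans hsmall.le
    have h2 : N₁ ^ σ ≤ N ^ σ := Real.rpow_le_rpow (Real.rpow_nonneg hB0 _) h1 hσ.le
    rwa [hN₁, Real.rpow_inv_rpow hB0 hσ.ne'] at h2
  set xx : ℝ := N ^ (σ / 2) with hxx
  set L₀ : ℕ := ⌊xx⌋₊ with hL₀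
  set m₀ : ℕ := ⌈N ^ ((1 : ℝ) / 2 + σ) / A⌉₊ with hm₀
  obtain ⟨hL1, hLm, hLinv, hlevel⟩ :=
    StubCollarAssembly.collar_arith hN1 hσ hA1 hq0 hNA hNB hxx hL₀ hm₀
  -- the tiling maps, unit families and sprinkled events, per offset
  set t : (Fin 3 → ℤ) → Site 3 → Site 3 := fun o z j => (z j - o j) / (4 * (r : ℤ) + 2) with ht
  set 𝒰 : (Fin 3 → ℤ) → Finset (Finset (Sym2 (Site 3))) := fun o =>
    (Λ.image (t o)).image (fun ι => (Λ.sym2).filter (fun e => e ∈ (zdGraph 3).edgeSet ∧ ∀ z ∈ e, t o z = ι)) with h𝒰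
  set E' : (Fin 3 → ℤ) → Set (BondConfig (Site 3)) := fun o => {ω' | ∃ x ∈ Λ, ∃ y ∈ Λ,
      δ * (Λ.card : ℝ) ≤ (((Λ.filter fun v => ω' ∈ openConnIn ↑Λ x v)).card : ℝ) ∧
      δ * (Λ.card : ℝ) ≤ (((Λ.filter fun v => ω' ∈ openConnIn ↑Λ y v)).card : ℝ) ∧
      ω' ∉ openConnIn ↑Λ x y ∧
      m₀ ≤ ((𝒰 o).filter fun W => ∃ a : Site 3, (box 3 r).image (· + a) ⊆ Λ ∧
        (∀ b ∈ (box 3 r).image (· + a), ∀ c ∈ (box 3 r).image (· + a), (zdGraph 3).Adj b c → s(b, c) ∈ W) ∧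
        (∃ u ∈ Λ, (Finset.univ.sup fun j : Fin 3 => (u j - a j).natAbs) ≤ r ∧ ω' ∈ openConnIn ↑Λ x u) ∧
        (∃ u ∈ Λ, (Finset.univ.sup fun j : Fin 3 => (u j - a j).natAbs) ≤ r ∧ ω' ∈ openConnIn ↑Λ y u)).card}
    with hE'
  -- per-offset bound
  have hbound : ∀ o : Fin 3 → ℤ, μ.real (E' o) ≤ K * N ^ (-(σ / 2)) := by
    intro o
    have h1 : ∀ W ∈ 𝒰 o, ∀ e ∈ W, e ∈ (zdGraph 3).edgeSet ∧ e ∈ Λ.sym2 :=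
      StubCollarAssembly.units_subset Λ (t o)
    have h2 : (↑(𝒰 o) : Set (Finset (Sym2 (Site 3)))).PairwiseDisjoint id :=
      StubCollarAssembly.units_pairwiseDisjoint Λ (t o)
    have h3 : ∀ W ∈ 𝒰 o, W.card ≤ u := by
      intro W hW
      obtain ⟨ι, -, rfl⟩ := Finset.mem_image.1 hW
      exact card_tileUnit_le r o Λ ι
    have hcardU : ((𝒰 o).card : ℝ) ≤ N := by
      have h : (𝒰 o).card ≤ Λ.card := StubCollarAssembly.card_units_le Λ (t o)
      rw [hN]; exact_mod_cast h
    obtain ⟨k, hk, hQ⟩ := hGrid p Λ (𝒰 o) h1 h2 δ hδ r m₀ L₀ hL1 hLm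
    obtain ⟨hs0, hs1, hwin, htv⟩ := hlevel k hk
    have hwin' : ((𝒰 o).card : ℝ) * ((k : ℝ) / m₀) ^ 2 ≤ (p : ℝ) ^ u :=
      le_trans (mul_le_mul_of_nonneg_right hcardU (sq_nonneg _)) hwin
    have hdet := StubCollarAssembly.determinedBy_goodUnitsEvent Λ (𝒰 o) δ r m₀
    have hW := hWindow p hp0 u Λ (𝒰 o) h1 h2 h3 ((k : ℝ) / m₀) hs0 hs1 hwin' _ hdet
    have hW' := (abs_sub_le_iff.1 hW).2
    -- `P ≤ Q + s√(|𝒰|/p^u) ≤ 1/(δ²L₀) + s√(N/q)`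
    have hsqrt : Real.sqrt (((𝒰 o).card : ℝ) / (p : ℝ) ^ u) ≤ Real.sqrt (N / q) :=
      Real.sqrt_le_sqrt (div_le_div_of_nonneg_right hcardU hq0.le)
    have hP : μ.real (E' o) ≤ 1 / (δ ^ 2 * L₀) + (k : ℝ) / m₀ * Real.sqrt (N / q) := by
      have := mul_le_mul_of_nonneg_left hsqrt hs0
      change μ.real (E' o) - _ ≤ _ at hW'
      linarith
    have hterm1 : 1 / (δ ^ 2 * L₀) ≤ 1 / δ ^ 2 * (2 * N ^ (-(σ / 2))) := by
      rw [← one_div_mul_one_div]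
      exact mul_le_mul_of_nonneg_left hLinv (by positivity)
    calc μ.real (E' o) ≤ 1 / (δ ^ 2 * L₀) + (k : ℝ) / m₀ * Real.sqrt (N / q) := hP
      _ ≤ 1 / δ ^ 2 * (2 * N ^ (-(σ / 2))) + A / Real.sqrt q * N ^ (-(σ / 2)) := add_le_add hterm1 htv
      _ = K * N ^ (-(σ / 2)) := by rw [hK]; ring
  -- inclusion into the union over offsets
  have hincl : {ω | ∃ x ∈ Λ, ∃ y ∈ Λ, δ * (Λ.card : ℝ) ≤ (((Λ.filter fun v => ω ∈ openConnIn ↑Λ x v)).card : ℝ) ∧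
            δ * (Λ.card : ℝ) ≤ (((Λ.filter fun v => ω ∈ openConnIn ↑Λ y v)).card : ℝ) ∧
            ω ∉ openConnIn ↑Λ x y ∧
            ((Λ.card : ℝ)) ^ ((1 : ℝ) / 2 + σ) ≤
              (Set.ncard {a : Site 3 | a ∈ Λ ∧ (box 3 r).image (· + a) ⊆ Λ ∧ (∃ u ∈ Λ, (Finset.univ.sup fun j : Fin 3 => (u j - a j).natAbs) ≤ r ∧ ω ∈ openConnIn ↑Λ x u) ∧ (∃ u ∈ Λ, (Finset.univ.sup fun j : Fin 3 => (u j - a j).natAbs) ≤ r ∧ ω ∈ openConnIn ↑Λ y u)} : ℝ)}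
      ⊆ ⋃ o ∈ Fintype.piFinset (fun _ : Fin 3 => ({0, 2 * (r : ℤ) + 1} : Finset ℤ)), E' o := by
    rintro ω ⟨x, hx, y, hy, hdx, hdy, hnot, hV⟩
    obtain ⟨o, ho, hcnt⟩ := hGeom r Λ ω x y
    refine Set.mem_iUnion₂.2 ⟨o, mem_offsets ho, ?_⟩
    simp only [hE', Set.mem_setOf_eq]
    refine ⟨x, hx, y, hy, hdx, hdy, hnot, ?_⟩
    -- number of good tiles ≥ m₀, and good tiles inject into good units
    have hT := StubCollarAssembly.ncard_goodTiles_le_card_goodUnits hr1 Λ (t o)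
      (fun a => ∃ u ∈ Λ, (Finset.univ.sup fun j : Fin 3 => (u j - a j).natAbs) ≤ r ∧ ω ∈ openConnIn ↑Λ x u)
      (fun a => ∃ u ∈ Λ, (Finset.univ.sup fun j : Fin 3 => (u j - a j).natAbs) ≤ r ∧ ω ∈ openConnIn ↑Λ y u)
    refine le_trans (Nat.ceil_le.2 ?_) hT
    rw [div_le_iff₀ hA0]
    calc N ^ ((1 : ℝ) / 2 + σ) ≤ A * _ := hV.trans hcnt
      _ = _ * A := mul_comm _ _
  -- union bound
  calc μ.real _ ≤ μ.real (⋃ o ∈ Fintype.piFinset (fun _ : Fin 3 => ({0, 2 * (r : ℤ) + 1} : Finset ℤ)), E' o) :=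
        measureReal_mono hincl (measure_ne_top _ _)
    _ ≤ ∑ o ∈ Fintype.piFinset (fun _ : Fin 3 => ({0, 2 * (r : ℤ) + 1} : Finset ℤ)), μ.real (E' o) :=
        measureReal_biUnion_finset_le _ _
    _ ≤ ∑ _o ∈ Fintype.piFinset (fun _ : Fin 3 => ({0, 2 * (r : ℤ) + 1} : Finset ℤ)), K * N ^ (-(σ / 2)) :=
        Finset.sum_le_sum fun o _ => hbound o
    _ = (Fintype.piFinset (fun _ : Fin 3 => ({0, 2 * (r : ℤ) + 1} : Finset ℤ))).card * (K * N ^ (-(σ / 2))) := by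
        rw [Finset.sum_const, nsmul_eq_mul]
    _ ≤ 8 * (K * N ^ (-(σ / 2))) := by
        gcongr
        exact_mod_cast card_offsets_le r
    _ ≤ (8 * K + M ^ (σ / 2)) * N ^ (-(σ / 2)) := by
        have : 0 ≤ M ^ (σ / 2) * N ^ (-(σ / 2)) := by positivity
        nlinarith [this]



end Summit.CriticalPhenomena.PercolationContinuityZ3.Theorems.FreeBoxSparse

end
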